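import Summits.QuantumFields.BalabanUV.T4Continuum.Spine.NE1p.DressedTowerWitness
import Summits.QuantumFields.BalabanUV.T4Continuum.Spine.NE1p.DressedTransportUniformWin

/-!
# T⁴ programme, spine estimate NE1′ (node O3b/H2) — FUNCTION-LEVEL NON-VACUITY AT EVERY CUTOFF WITH ONE K-FREE `U` AND ONE
# CUTOFF-FREE SCHEDULE, part 2 of 2: END-F-win BY NAME on the datum, the leaf bundle with ONE `U`, END-B and the ROOT
# (formalisation crew `b2b-balaban-t4-ne1p-formalise-*`, leaf seat 03, generation 2, row W5; own-initiative consistency item,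
# NOT a crew estimate row)

Cell `pub-balaban`, sub-cell `t4`, BINDER-OWNERS row NE1′ (owner lineage t4-ne1p-p1).  ADDITIVE — imports part 1
`Spine/NE1p/DressedTowerWitness` (the K-free scalars `LW`, `ψ = LW⁻²`, the one schedule `Wg`, the two-atom measures `flAt`, the
datum `BW`∕`TW`∕`towerW`∕`FnW`∕`dirW`; p213903) — through it leaf-04's `DressedWindowScheduleWin` (END-F-win under a per-step-window
schedule, p213367), leaf-09's `DressedUniformConstants` (row S3's cell, p212599) and the lineage toy calculus — and leaf-09's
`Spine/NE1p/DressedTransportUniformWin` (row S3g part 1: `bookingLeaves_win_of_schedule`, `dressedStability_win_of_cell`, p213769)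
for the BY-NAME route of §6; modifies nothing.  One namespace for both parts.

CONTENTS.  §4 every displayed binder of `DressedWindowScheduleWin.transportLeaf_win_of_schedule` on the datum: (w1) `hslW`
(birth slices on the birth window `bondBall c_W`, bound `a_K·(c_W + 3)`), (w2-act) `realBaseAt_W` ∕ `exponentSliceAt_W` (ZERO action
exponent — inhabited by constants; the non-trivial K = 2 instance is W1 ∕ W2's), F-4 `pertSlice_W` (centred observable exponent
`0 − 0`, a slice of every nonnegative size, here the dressed budget share `¼·Σ envVar ≥ 0`, `budgetShare_nonneg`), `hDμW` (both
atoms inside `bondBall (σ k)`), (w4) `hdomW` DISCHARGED by the schedule's cutoff-free ratio through row S3's `hdom_cell`, (I4′)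
`hdefwkW` ∕ `hrateW` (defect `ψ^k∕2` inside the chart window `ψ^k∕2`, decaying at the transport rate), attainment `hlinW`
(`lin b 0 k = a_K·δ_k` is EXACTLY the oscillation of `FnW K 0 k` between `0` and its gauge image `δ_k·e₀₀` — the dressing
`shift k` cancels).  §5 END-B's booking-level binders: `hcountW` ((w3-book), one live family, `N₀ = 1`, `Λ = L⁴`), `hbirthW`
((w1)+(w5b) by `birthsFromOld_of_diag`: `C·gen = 2·a_K·(c_W + 3) = τ^K = twoRate 1 ρ₁ τ K 0 0` EXACTLY), `hregW` (no
regeneration).  §6 **`htrW K`** = `transportLeaf_win_of_schedule Wg …` BY NAME with its 14 displayed binders discharged — the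
transport leaf at EVERY cutoff along the ONE schedule; **`UW`** = `uniformConstantsCell LW (4·½∕1) 0 ½ 1 1 ¼ ½ ½ …` (ONE `U`,
located largeness `locCell = ½` by the choice `L := 2·alphaCell ½`, (w6) window with EQUALITY — gate active); **`leavesW K :
BookingLeaves UW (BW K) (TW K)`** by row S3's `bookingLeavesCell`; `classAt_towerW` (END-B's per-cutoff face: the class AND every
dressed budget gate); **`dressedStability_towerW : DressedStability towerW`** by `dressedStability_of_cell` — ONE `U` preceding
`∀ K`; the SAME bundle and root once more through leaf-09's S3g face BY NAME — **`leavesW' K : BookingLeaves UW (BW K) (TW K)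
:= bookingLeaves_win_of_schedule Wg hratioW …`** (every displayed binder of S3g's bundle discharged, at every cutoff, over the same
`UW`) and **`dressedStability_towerW' := dressedStability_win_of_cell towerW … (fun _ K => leavesW' K)`**; `towerW_size_pos`;
`FnW_one_ne_birth` (the averaging step genuinely acts).

HONEST FRAMING.  A decided toy: [folklore] kernel mathematics, 0 sorry, 0 citations, no `def … : Prop`; NOTHING of Bałaban's
densities or of [Balaban1989LargeFieldII] (1.71)–(1.75) pp. 379–380 is modelled or asserted (CONTEXT only, via the imported headers).
VALUE = a joint-satisfiability certificate, UNIFORM IN THE CUTOFF, for the window-face binder family (END-F-win's displayed binders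
∪ END-B's per-cutoff leaf binders) with ONE K-free `U` and ONE cutoff-free schedule — k1's quantifier order `∃ U ∀ K` exercised at
function level; it says NOTHING about whether the cell's D-terms meet the shapes; LF-2 stands (cutoff-free WITH `hP` displayed; an
ASSEMBLED `hP` costs `K·w` until row S1e).  Headline: «the window-face binder SHAPES jointly inhabited at every cutoff by one
K-free `U` — non-vacuity, nothing of Bałaban's densities; NE1′ NOT proved; walls (w1)–(w7) unchanged».  Rung (B)+1 on ONE finite
four-torus — NOT infinite volume, NOT a mass gap, NOT OS on ℝ⁴, NOT Clay, NOT summit progress; spine PROVED 0∕9.  HONEST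
DEPENDENCY: continuum YM on T⁴ ⇐ BetaPertH ∧ nine spine estimates (0/9 proved); BetaPertH ⇐ (D1) ∧ (D4) ∧ CAP+tail; G-an2-4
gates asym, D1 and NE2/3/4.
-/

noncomputable section

namespace Summit.QuantumFields.BalabanUV.T4Continuum.NE1p.DressedTowerWitness

open MeasureTheory Set Metric Filter Finset
open scoped BigOperators
open Literature.MathematicalPhysics.QuantumFieldTheory.Balaban1983to89
open Literature.MathematicalPhysics.QuantumFieldTheory.Balaban1983to89.T4TermFormat
open Literature.MathematicalPhysics.QuantumFieldTheory.Balaban1983to89.T4TermFormat.Booking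
open Literature.MathematicalPhysics.QuantumFieldTheory.Balaban1983to89.T4GatedBooking
open Literature.MathematicalPhysics.QuantumFieldTheory.Balaban1983to89.T4TrajectoryComparison
open T4TrajectoryModulus (bondBall bondBall_add_mem bondBall_latMove_add_mem bondBall_diam)
open T4BlockTransport (Fld NDir latMove latN Site norm_dir_le)
open T4BirthChartTransport (GaugeInvariant BirthSlice RelGauge)
open T4TrajectoryDensity
open Summit.QuantumFields.BalabanUV.T4Continuum.T4TrajectoryDensityDressed
open Summit.QuantumFields.BalabanUV.T4Continuum.T4TrajectoryDensityWitness
open Summit.QuantumFields.BalabanUV.T4Continuum.NE1p.DressedRoot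
open Summit.QuantumFields.BalabanUV.T4Continuum.NE1p.DressedUniformConstants
open Summit.QuantumFields.BalabanUV.T4Continuum.NE1p.DressedWindowScheduleWin
open Summit.QuantumFields.BalabanUV.T4Continuum.NE1p.DressedTransportUniformWin

/-! ## §4 END-F-win's displayed binders on the datum [folklore] -/

/-- `hsl` (w1): the birth slices — generation `0` is `a_K·U₀₀`, entire along every chart and bounded by `a_K·(c_W + 3)` on the
discs over the birth window `bondBall c_W`; later generations are `0` with bound `0`. [folklore] -/
theorem hslW (K : ℕ) (b : (BW K).Birth) (k' : ℕ) :
    BirthSlice (FnW K k' k') latMove latN (bondBall 4 (Wg.ρw k') : Set (Fld 4 ℂ)) 1 1 ((TW K).gen b k') := by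
  intro U hU p hp hp1
  by_cases hk : k' = 0
  · subst hk
    have hUc : ‖ev₀₀ U‖ ≤ cW := by rw [← Wg_ρw_zero]; exact hU 0 0
    refine ⟨ball 0 (3 / latN p), ?_, fun t ht => ?_, discs_subset_ball hp hp1 (by norm_num)⟩
    · simp only [FnW, ↓reduceIte, ev₀₀_latMove]; fun_prop
    · show ‖FnW K 0 0 (latMove U p t)‖ ≤ (if (0 : ℕ) = 0 then aK K * (cW + 3) else 0)
      simp only [FnW, ↓reduceIte, ev₀₀_latMove, shiftW, add_zero]
      have h3 := norm_t_mul_le p hp ht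
      rw [norm_mul, Complex.norm_real, Real.norm_eq_abs, abs_of_pos (aK_pos K)]
      calc aK K * ‖ev₀₀ U + t * ev₀₀ p.1.1‖ ≤ aK K * (‖ev₀₀ U‖ + ‖t * ev₀₀ p.1.1‖) :=
            mul_le_mul_of_nonneg_left (norm_add_le _ _) (aK_pos K).le
        _ ≤ aK K * (cW + 3) := mul_le_mul_of_nonneg_left (by linarith) (aK_pos K).le
  · refine ⟨univ, ?_, fun t _ => ?_, fun _ _ => subset_univ _⟩
    · simp only [FnW, if_neg hk]; fun_prop
    · show ‖FnW K k' k' (latMove U p t)‖ ≤ (if k' = 0 then aK K * (cW + 3) else 0)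
      simp [FnW, hk]

/-- `hB` (w2-act): the real regular reference for the ZERO action exponent — `base ≡ 1` with full support of positive mass,
reality and integrability at both atoms (inhabited trivially; W1 ∕ W2 carry the non-trivial K = 2 instance). [folklore] -/
theorem realBaseAt_W (a : Fld 4 ℂ) (S : Set (Fld 4 ℂ)) : RealBaseAt (fun U : Fld 4 ℂ => U) base₁ zeroExp (flAt a) S := by
  refine ⟨Eventually.of_forall fun _ => zero_le_one, ?_,
    fun U₀ _ => ⟨aesm_flAt a _, ae_flAt.mpr ⟨by simp [zeroExp], by simp [zeroExp]⟩, integrable_flAt a _⟩⟩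
  rw [show Function.support base₁ = univ from Function.support_const one_ne_zero]
  simp [flAt]

/-- `hE` (w2-act): the exponent slice of the ZERO action exponent — holomorphic (constant), oscillation `0`. [folklore] -/
theorem exponentSliceAt_W (a : Fld 4 ℂ) (S : Set (Fld 4 ℂ)) (ϱ : ℝ) :
    ExponentSliceAt (fun U : Fld 4 ℂ => U) zeroExp (flAt a) latMove latN S 1 ϱ 0 := fun _ _ _ _ _ =>
  ⟨univ, isOpen_univ, fun _ _ => subset_univ _, fun _ _ => aesm_flAt a _,
    Eventually.of_forall fun _ => by simp only [zeroExp]; exact differentiableOn_const 0,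
    Eventually.of_forall fun _ _ _ => by simp [zeroExp]⟩

/-- `hP` (F-4, DISPLAYED on the window face): the centred observable-attached exponent is `0 − 0`, a perturbation slice of
every nonnegative size — in particular of the dressed budget share `m·Σ envVar`. [folklore] -/
theorem pertSlice_W (a : Fld 4 ℂ) (S : Set (Fld 4 ℂ)) (ϱ : ℝ) {s₁ : ℝ} (hs : 0 ≤ s₁) :
    PertSlice (fun (U z : Fld 4 ℂ) => zeroExp U z - 0) (flAt a) latMove latN S 1 ϱ s₁ := by
  have h : (fun (U z : Fld 4 ℂ) => zeroExp U z - 0) = fun _ _ => (0 : ℂ) := by funext U z; simp [zeroExp]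
  rw [h]
  exact (pertSlice_const (μ := flAt a) (move := latMove) (N := latN) (𝒦 := S) (w := 1) (ϱ := ϱ) 0).mono hs le_rfl
    Subset.rfl

/-- The dressed budget share of the single live family is nonnegative (the size `hP` is asked at). [folklore] -/
theorem budgetShare_nonneg (K : ℕ) (b : (BW K).Birth) (k : ℕ) :
    0 ≤ 1 / 4 * ∑ f ∈ ({b} : Finset (BW K).Birth),
      (TW K).envVar (4 * (1 / 2) / 1) (fun i => (LW ^ 2)⁻¹ * (fun _ : ℕ => alphaCell (1 / 2)) i) f k :=
  mul_nonneg (by norm_num) (sum_nonneg fun f _ =>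
    Trajectory.envVar_nonneg (by norm_num) (fun _ => mul_nonneg psi_pos.le (alphaCell_nonneg (by norm_num))) f k)

/-- `hDμ`: both atoms of the step-`k` fluctuation measure lie in `bondBall (σ k) = bondBall (ψ^k∕4)`. [folklore] -/
theorem hDμW (k : ℕ) : ∀ᵐ z ∂flAt (atomW k), z ∈ (bondBall 4 (Wg.σ k) : Set (Fld 4 ℂ)) := by
  refine ae_flAt.mpr ⟨fun x ν => ?_, fun x ν => ?_⟩
  · rw [Wg_σ, Pi.zero_apply, Pi.zero_apply, norm_zero]; have := psi_pos; positivity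
  · rw [Wg_σ]
    simp only [atomW, Complex.norm_real, Real.norm_eq_abs]
    rw [abs_of_nonneg (by have := psi_pos; positivity)]
    linarith

/-- **THE SCHEDULE's K-FREE RATIO** `2σ k = ψ^k∕2 ≤ ½·ϱc k` (κ = ½) — leaf-09's S3g binder `hratio` on the ONE schedule. [folklore] -/
theorem hratioW : ∀ k, 2 * Wg.σ k ≤ 1 / 2 * Wg.ϱc k := fun k => by
  rw [Wg_σ, Wg_ϱc]; have := psi_pow_le_one k; linarith

/-- `hdom` (w4) DISCHARGED by the schedule's cutoff-free ratio: `e³·(1 + 4·2σ k∕ϱc k) ≤ alphaCell ½` (row S3's `hdom_cell`).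
[folklore] -/
theorem hdomW (K k : ℕ) (_hk : k + 1 ≤ (BW K).K) :
    Real.exp 3 * (1 + 4 * (2 * Wg.σ k) / Wg.ϱc k) ≤ (fun _ : ℕ => alphaCell (1 / 2)) k :=
  hdom_cell (Wg.hϱc k) (hratioW k)

/-- `hdefwk`: the defect `ψ^k∕2` is within the step's chart window `wc k = 2·¼·ψ^k`. [folklore] -/
theorem hdefwkW (k : ℕ) : defW k ≤ Wg.wc k := by rw [Wg_wc]; unfold defW; linarith

/-- `hrate` (I4′): the defect decays at the transport rate from any generation scale, `ψ^k∕2 ≤ ½·ψ^{k−k′}`. [folklore] -/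
theorem hrateW (k' k : ℕ) : defW k ≤ 1 / 2 * ((LW ^ 2)⁻¹) ^ (k - k') := by
  unfold defW
  exact mul_le_mul_of_nonneg_left (pow_le_pow_of_le_one psi_pos.le psi_le_one (Nat.sub_le k k')) (by norm_num)

/-- `hlin` — THE TRAJECTORY CURRENCY FROM THE CARRIED FUNCTIONALS: base `0 ∈ bondBall (ρw k)`, gauge image `δ_k·e₀₀` along
`dirW k` (defect `δ_k`), and `lin b 0 k = a_K·δ_k = ‖FnW K 0 k (δ_k·e₀₀) − FnW K 0 k 0‖` EXACTLY (the dressing `shift k` cancels);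
later generations have `lin = 0`. [folklore] -/
theorem hlinW (K : ℕ) (b : (BW K).Birth) (k' k : ℕ) (ε : ℝ) (hε : 0 < ε) :
    ∃ U₀ ∈ (bondBall 4 (Wg.ρw k) : Set (Fld 4 ℂ)), ∃ U₁ : Fld 4 ℂ,
      RelGauge (fun U U' : Fld 4 ℂ => U = U') latMove latN U₀ U₁ (defW k) ∧
        (TW K).lin b k' k ≤ ‖FnW K k' k U₁ - FnW K k' k U₀‖ + ε := by
  refine ⟨0, zero_mem_window k, latMove 0 (dirW k) 1, ⟨dirW k, defW_pos k, le_rfl, rfl⟩, ?_⟩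
  show (if k' = 0 then aK K * defW k else 0) ≤ _
  by_cases hk : k' = 0
  · subst hk
    simp only [↓reduceIte, FnW, ev₀₀_move_dirW, ev₀₀_zero, zero_add]
    rw [show (aK K : ℂ) * (((defW k : ℝ) : ℂ) + shiftW k) - (aK K : ℂ) * shiftW k = ((aK K * defW k : ℝ) : ℂ) by
        push_cast; ring,
      Complex.norm_real, Real.norm_eq_abs, abs_of_pos (mul_pos (aK_pos K) (defW_pos k))]
    linarith
  · simp only [if_neg hk]; positivity

/-! ## §5 END-B's booking-level binders on the datum [folklore] -/

/-- (w3-book) `hcount`: one live family, count `≤ 1 ≤ N₀·Λ^{k−j}` with `N₀ = 1`, `Λ = L⁴ ≥ 1`. [folklore] -/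
theorem hcountW (K : ℕ) : ∀ (k : ℕ) (b : (BW K).Birth), ∀ j ≤ k,
    (((({b} : Finset (BW K).Birth)).filter fun f => (BW K).birthScale f = j).card : ℝ) ≤ 1 * (LW ^ 4) ^ (k - j) := by
  intro k b j _
  have h1 : (((({b} : Finset (BW K).Birth)).filter fun f => (BW K).birthScale f = j).card : ℝ) ≤ 1 := by
    exact_mod_cast (Finset.card_filter_le _ _).trans (Finset.card_singleton b).le
  exact h1.trans (by simpa using one_le_pow₀ (M₀ := ℝ) (a := LW ^ 4) (n := k - j) (one_le_pow₀ one_le_LW))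

/-- (w1)+(w5b) `hbirth` by `birthsFromOld_of_diag`: `C·gen b 0 = 2·a_K·(c_W + 3) = τ^K = twoRate 1 ρ₁ τ K 0 0` EXACTLY. [folklore] -/
theorem hbirthW (K : ℕ) :
    (TW K).BirthsFromOld (4 * (1 / 2) / 1) (fun _ : ℕ => (LW ^ 2)⁻¹ * alphaCell (1 / 2))
      (twoRate 1 (rhoOne (LW ^ 2)⁻¹ (4 * (1 / 2) / 1) 0 (1 / 2)) (LW⁻¹ ^ 3) (BW K).K)
      (budgetGate (TW K) (fun _ _ => 0) (1 / 4) (fun _ b => {b}) (4 * (1 / 2) / 1)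
        (fun _ : ℕ => (LW ^ 2)⁻¹ * alphaCell (1 / 2))) :=
  Trajectory.birthsFromOld_of_diag fun b => by
    show 4 * (1 / 2) / 1 * (if (0 : ℕ) = 0 then aK K * (cW + 3) else 0) ≤
      twoRate 1 (rhoOne (LW ^ 2)⁻¹ (4 * (1 / 2) / 1) 0 (1 / 2)) (LW⁻¹ ^ 3) K 0 0
    have hc : 0 < cW + 3 := by linarith [cW_pos]
    simp only [↓reduceIte, twoRate, Nat.sub_zero, pow_zero, mul_one, one_mul]
    unfold aK
    rw [show 4 * (1 / 2 : ℝ) / 1 * ((LW⁻¹ ^ 3) ^ K / (2 * (cW + 3)) * (cW + 3)) = (LW⁻¹ ^ 3) ^ K by field_simp; ring]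

/-- (w5) `hreg`: no regeneration (later generations are `0`). [folklore] -/
theorem hregW (K : ℕ) : (TW K).RegeneratesFromVar (fun _ : ℕ => (0 : ℝ))
    (budgetGate (TW K) (fun _ _ => 0) (1 / 4) (fun _ b => {b}) (4 * (1 / 2) / 1)
      (fun _ : ℕ => (LW ^ 2)⁻¹ * alphaCell (1 / 2))) :=
  fun b k _ _ _ => by
    show (if k + 1 = 0 then aK K * (cW + 3) else 0) ≤ 0 * ((BW K).size b k)
    simp

/-! ## §6 END-F-win BY NAME on the datum, the bundle with ONE `U`, END-B, the ROOT [folklore] -/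

/-- **END-F-win ON THE DATUM** — `DressedWindowScheduleWin.transportLeaf_win_of_schedule` BY NAME along the ONE schedule `Wg`,
every displayed binder discharged (§4): the transport leaf `htr` at `C = 4·½∕1`, rate `ψ·alphaCell ½`, gated by the dressed budget
with `m = ¼`, at EVERY cutoff `K`. [folklore] -/
theorem htrW (K : ℕ) :
    (TW K).TransportsFromVar (4 * (1 / 2) / 1) (fun i => (LW ^ 2)⁻¹ * (fun _ : ℕ => alphaCell (1 / 2)) i)
      (budgetGate (TW K) (fun _ _ => 0) (1 / 4) (fun _ b => {b}) (4 * (1 / 2) / 1)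
        (fun i => (LW ^ 2)⁻¹ * (fun _ : ℕ => alphaCell (1 / 2)) i)) :=
  transportLeaf_win_of_schedule Wg (T := TW K) (Fn := fun _ k' k => FnW K k' k) (rel := fun _ _ _ U U' => U = U')
    (ref := fun _ _ U => U) (base := fun _ _ => base₁) (𝒜 := fun _ _ => zeroExp) (𝒬 := fun _ _ => zeroExp)
    (q := fun _ _ _ => 0) (μ := fun _ k => flAt (atomW k)) (z₀ := fun _ _ => 0) (defect := fun _ _ k => defW k)
    (cδ := 1 / 2) (ψ := (LW ^ 2)⁻¹) (m := 1 / 4) (s := fun _ _ => 0) (α := fun _ : ℕ => alphaCell (1 / 2))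
    (S := fun _ b => {b})
    (fun _ => alphaCell_nonneg (by norm_num)) one_pos (fun b k' _ _ _ => hslW K b k')
    (fun _ k' k _ _ _ _ U => FnW_succ K k' k U) (fun _ _ k _ _ _ _ _ => mem_bddClass_flAt _ _)
    (fun _ _ k _ _ _ _ => realBaseAt_W _ _) (fun _ _ k _ _ _ _ => exponentSliceAt_W _ _ _)
    (fun b _ k _ _ _ _ => pertSlice_W _ _ _ (budgetShare_nonneg K b k)) (fun _ k => hDμW k) (fun k hk => hdomW K k hk)
    (fun _ _ _ _ _ h => h ▸ rfl) (fun _ _ k => hdefwkW k) (fun _ k' k _ _ _ => hrateW k' k)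
    (fun b k' k _ _ _ _ ε hε => hlinW K b k' k ε hε)

/-- **THE ONE SET OF UNIFORM CONSTANTS** [decided toy]: `uniformConstantsCell L (4·½∕1) 0 ½ 1 1 ¼ ½ ½` — row S3's constructor
with the located largeness `locCell = ½ ≤ ρ′ = ½` (by the choice of `L`) and the (w6) window `¼·(1·1·(1−½)⁻¹) = ½ ≤ 1 − ½`
(EQUALITY: the gate is active).  It precedes `∀ K`. [folklore] -/
def UW : UniformConstants :=
  uniformConstantsCell LW (4 * (1 / 2) / 1) 0 (1 / 2) 1 1 (1 / 4) (1 / 2) (1 / 2) one_le_LW (by norm_num) le_rfl (by norm_num)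
    zero_le_one zero_le_one (by norm_num) (locCell_LW _).le (by norm_num) (by norm_num)

/-- **THE LEAF BUNDLE AT CUTOFF `K` WITH THE ONE `U`** — row S3's `bookingLeavesCell` with `htr := htrW K` (END-F-win by name),
`hbirth`, `hreg`, `hcount` from §5, no regeneration constants, zero action margins. [folklore] -/
def leavesW (K : ℕ) : BookingLeaves UW (BW K) (TW K) :=
  bookingLeavesCell one_le_LW (by norm_num) le_rfl (by norm_num) zero_le_one zero_le_one (by norm_num) (locCell_LW _).le
    (by norm_num) (by norm_num) (fun _ => 0) (fun _ _ => 0) (fun _ b => {b}) (fun _ => le_rfl) (fun _ _ => le_rfl)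
    (fun k _ _ _ => Nat.zero_le k) (hcountW K) (fun _ _ => by norm_num) (hbirthW K) (htrW K) (hregW K)

/-- **END-B's PER-CUTOFF FACE ON THE DATUM**: the class AND every dressed budget gate along the trajectory, at every cutoff. [folklore] -/
theorem classAt_towerW (K : ℕ) :
    ClassAt (BW K) UW.A₀ UW.ρ₁ UW.τ ∧ ∀ k, k ≤ (BW K).K → RanBelow (budgetGate (TW K) (leavesW K).s₀ UW.m (leavesW K).S UW.C
      (leavesW K).ρ) k :=
  classAt_of_bookingLeaves (leavesW K)

/-- **NON-VACUITY OF THE ROOT THROUGH THE WINDOW-FACE PIPELINE, AT FUNCTION LEVEL, UNIFORMLY IN THE CUTOFF** [decided toy]: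
`DressedStability towerW` by row S3's `dressedStability_of_cell` — ONE `U` (ONE `L`, ONE schedule) preceding `∀ K`, the transport
leaf at every cutoff supplied by END-F-win on the functionals. [folklore] -/
theorem dressedStability_towerW : DressedStability towerW :=
  dressedStability_of_cell towerW one_le_LW (by norm_num) le_rfl (by norm_num) zero_le_one zero_le_one (by norm_num)
    (locCell_LW _).le (by norm_num) (by norm_num) fun _ K => leavesW K

/-- **LEAF-09's S3g BUNDLE BY NAME ON THE DATUM** — `DressedTransportUniformWin.bookingLeaves_win_of_schedule Wg hratioW …` with
every one of its displayed binders discharged, at EVERY cutoff, over the SAME `UW` (the `hκ`∕`hC` proofs inside the constants differ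
only by proof irrelevance). [folklore] -/
def leavesW' (K : ℕ) : BookingLeaves UW (BW K) (TW K) :=
  bookingLeaves_win_of_schedule Wg (T := TW K) (Fn := fun _ k' k => FnW K k' k) (rel := fun _ _ _ U U' => U = U')
    (ref := fun _ _ U => U) (base := fun _ _ => base₁) (𝒜 := fun _ _ => zeroExp) (𝒬 := fun _ _ => zeroExp)
    (q := fun _ _ _ => 0) (μ := fun _ k => flAt (atomW k)) (z₀ := fun _ _ => 0) (defect := fun _ _ k => defW k)
    (s := fun _ _ => 0) (S := fun _ b => {b})
    hratioW one_le_LW le_rfl zero_le_one zero_le_one (by norm_num) (locCell_LW _).le (by norm_num) (by norm_num) one_pos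
    (by norm_num) (fun b k' _ _ _ => hslW K b k') (fun _ k' k _ _ _ _ U => FnW_succ K k' k U)
    (fun _ _ k _ _ _ _ _ => mem_bddClass_flAt _ _) (fun _ _ k _ _ _ _ => realBaseAt_W _ _)
    (fun _ _ k _ _ _ _ => exponentSliceAt_W _ _ _) (fun b _ k _ _ _ _ => pertSlice_W _ _ _ (budgetShare_nonneg K b k))
    (fun _ k => hDμW k) (fun _ _ _ _ _ h => h ▸ rfl) (fun _ _ k => hdefwkW k) (fun _ k' k _ _ _ => hrateW k' k)
    (fun b k' k _ _ _ _ ε hε => hlinW K b k' k ε hε) (fun _ => le_rfl) (fun _ _ => le_rfl) (hregW K)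
    (fun _ _ => by norm_num) (fun k _ _ _ => Nat.zero_le k) (hcountW K) (hbirthW K)

/-- **THE ROOT THROUGH LEAF-09's END-B-OVER-BUNDLES** (`dressedStability_win_of_cell`) — the same tower, the same ONE `U`, the
S3g bundle at every cutoff. [folklore] -/
theorem dressedStability_towerW' : DressedStability towerW :=
  dressedStability_win_of_cell towerW one_le_LW le_rfl (by norm_num : (0 : ℝ) ≤ 1 / 2) zero_le_one zero_le_one (by norm_num)
    (locCell_LW _).le (by norm_num) (by norm_num) one_pos (by norm_num) fun _ K => leavesW' K

/-- The toy is non-degenerate: every booked size is positive at every cutoff and scale. [folklore] -/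
theorem towerW_size_pos (K k : ℕ) (b : (BW K).Birth) : 0 < (BW K).size b k := mul_pos (aK_pos K) (defW_pos k)

/-- The carried functional genuinely moves under the fluctuation step: `FnW K 0 1 ≠ FnW K 0 0` (the dressing `shift 1 = ⅛ ≠ 0`).
[folklore] -/
theorem FnW_one_ne_birth (K : ℕ) : FnW K 0 1 ≠ FnW K 0 0 := fun h => by
  have h0 := congrFun h 0
  have ha : (aK K : ℂ) ≠ 0 := by exact_mod_cast (aK_pos K).ne'
  norm_num [FnW, shiftW, ha] at h0

end Summit.QuantumFields.BalabanUV.T4Continuum.NE1p.DressedTowerWitness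

end
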